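import Mathlib

/-!
# Hadamard 668 census, family F12 — self-reciprocal factors of `Φ_p` over `𝔽_q` when `q` is self-conjugate mod `p` (kernel)

Framing: lottery ticket; floor = certified bounds/negative ranges.

Cell pub-namedobj (venture DiscreteObjects), target (H), hadamard gen 8.  General-prime version of `ParityCyclotomic29` (which
did `q = 167`, `p = 29`): for primes `p ≠ q` and an irreducible factor `h` of the cyclotomic polynomial `Φ_p` over `ZMod q`,
* `dvd_comp_X_pow_of_selfConj` — if `q^j ≡ -1 (mod p)` (hypothesis `q ^ j % p = p - 1`, '`q` self-conjugate mod `p`') then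
  `h ∣ h(X^{p-1})`: the root `α` of `h` in `𝔽_q[X]/(h)` has `α^p = 1` and `α^{p-1} = α^{q^j} = Frob^j(α)`, again a root;
* `isCoprime_of_mul_eq_X_pow_sub_one'` (`X^p - 1` separable since `p ≠ 0` in `𝔽_q`), `eval_one_ne_zero_of_dvd_cyclotomic`
  (`Φ_p(1) = p ≠ 0`), `eval_one_eq_zero_of_mul_eq'`, `cyclotomic_dvd_X_pow_sub_one'`, `natDegree_cyclotomic_prime`.
Used by `PrimeOrderParitySelfConj` (Lander's parity theorem 3.20(2) for the 2-(667,333,166) design at every self-conjugate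
prime).  Ours, not literature; no `sorry`.  Reference for the classical theorem: [cite:
book:lander1983-symmetric-designs-algebraic-approach, Thm 3.20(2) p.95].
-/

open Polynomial

namespace Summit.Ventures.DiscreteObjects.Hadamard

section zmodq
variable {q : ℕ} [Fact (Nat.Prime q)] {p : ℕ}

/-- `Φ_p · (X - 1) = X^p - 1` -/
lemma cyclotomic_mul_X_sub_one' (hp : p.Prime) : cyclotomic p (ZMod q) * (X - 1) = X ^ p - 1 := by
  haveI : Fact (Nat.Prime p) := ⟨hp⟩
  exact cyclotomic_prime_mul_X_sub_one (ZMod q) p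

/-- `Φ_p ∣ X^p - 1` -/
lemma cyclotomic_dvd_X_pow_sub_one' (hp : p.Prime) : cyclotomic p (ZMod q) ∣ X ^ p - 1 :=
  ⟨X - 1, (cyclotomic_mul_X_sub_one' hp).symm⟩

/-- `deg Φ_p = p - 1` -/
lemma natDegree_cyclotomic_prime (hp : p.Prime) : (cyclotomic p (ZMod q)).natDegree = p - 1 := by
  rw [natDegree_cyclotomic, Nat.totient_prime hp]

/-- a factor of `Φ_p` does not vanish at `1` when `p ≠ q` (`Φ_p(1) = p`) -/
lemma eval_one_ne_zero_of_dvd_cyclotomic (hp : p.Prime) (hpq : p ≠ q) {h : (ZMod q)[X]}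
    (hdvd : h ∣ cyclotomic p (ZMod q)) : h.eval 1 ≠ 0 := by
  haveI : Fact (Nat.Prime p) := ⟨hp⟩
  obtain ⟨g, hg⟩ := hdvd
  intro h0
  have e : (cyclotomic p (ZMod q)).eval 1 = 0 := by rw [hg, eval_mul, h0, zero_mul]
  rw [eval_one_cyclotomic_prime, ZMod.natCast_eq_zero_iff] at e
  exact hpq ((Nat.prime_dvd_prime_iff_eq (Fact.out : q.Prime) hp).mp e).symm

/-- the complementary factor vanishes at `1` -/
lemma eval_one_eq_zero_of_mul_eq' {h h' : (ZMod q)[X]} (hh' : h * h' = X ^ p - 1) (h1 : h.eval 1 ≠ 0) :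
    h'.eval 1 = 0 := by
  have e := congrArg (eval 1) hh'
  simp only [eval_mul, eval_sub, eval_pow, eval_X, one_pow, eval_one, sub_self] at e
  exact (mul_eq_zero.mp e).resolve_left h1

/-- complementary factors of the separable polynomial `X^p - 1` (`p ≠ q`) are coprime -/
lemma isCoprime_of_mul_eq_X_pow_sub_one' (hp : p.Prime) (hpq : p ≠ q) {h h' : (ZMod q)[X]}
    (hh' : h * h' = X ^ p - 1) : IsCoprime h h' := by
  have hsep : (X ^ p - 1 : (ZMod q)[X]).Separable := by
    have hp0 : ((p : ℕ) : ZMod q) ≠ 0 := by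
      rw [Ne, ZMod.natCast_eq_zero_iff]
      intro e
      exact hpq ((Nat.prime_dvd_prime_iff_eq (Fact.out : q.Prime) hp).mp e).symm
    have := separable_X_pow_sub_C (1 : ZMod q) hp0 one_ne_zero
    simpa using this
  rw [← hh'] at hsep
  exact hsep.isCoprime

/-- **Self-reciprocity.** If `q^j ≡ -1 (mod p)` then every irreducible factor `h` of `Φ_p` over `𝔽_q` divides `h(X^{p-1})`. -/
theorem dvd_comp_X_pow_of_selfConj (hp : p.Prime) {j : ℕ} (hj : q ^ j % p = p - 1) {h : (ZMod q)[X]}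
    (hirr : Irreducible h) (hdvd : h ∣ cyclotomic p (ZMod q)) : h ∣ h.comp (X ^ (p - 1)) := by
  haveI : Fact (Irreducible h) := ⟨hirr⟩
  set K := AdjoinRoot h with hK
  set α : K := AdjoinRoot.root h with hα
  -- α^p = 1
  have hαp : α ^ p = 1 := by
    obtain ⟨g, hg⟩ := dvd_trans hdvd (cyclotomic_dvd_X_pow_sub_one' hp)
    have e : aeval α (X ^ p - 1 : (ZMod q)[X]) = 0 := by
      rw [hg, map_mul, AdjoinRoot.aeval_eq, AdjoinRoot.mk_self, zero_mul]
    rw [map_sub, map_pow, aeval_X, map_one, sub_eq_zero] at e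
    exact e
  -- Frobenius^j on K
  haveI : CharP K q := charP_of_injective_algebraMap (algebraMap (ZMod q) K).injective q
  haveI : ExpChar K q := ExpChar.prime (Fact.out : q.Prime)
  let ψ : K →+* K := iterateFrobenius K q j
  have hψα : ψ α = α ^ (p - 1) := by
    show iterateFrobenius K q j α = α ^ (p - 1)
    rw [iterateFrobenius_def, ← Nat.div_add_mod (q ^ j) p, pow_add, pow_mul, hαp, one_pow, one_mul, hj]
  have hcomp : ψ.comp (algebraMap (ZMod q) K) = algebraMap (ZMod q) K := Subsingleton.elim _ _
  have hroot : h.eval₂ (algebraMap (ZMod q) K) (α ^ (p - 1)) = 0 := by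
    have e := Polynomial.hom_eval₂ h (algebraMap (ZMod q) K) ψ α
    rw [hcomp, hψα] at e
    rw [← e]
    have h0 : h.eval₂ (algebraMap (ZMod q) K) α = 0 := AdjoinRoot.eval₂_root h
    rw [h0, map_zero]
  rw [← AdjoinRoot.mk_eq_zero, ← AdjoinRoot.aeval_eq, aeval_comp, map_pow, aeval_X]
  exact hroot

end zmodq

end Summit.Ventures.DiscreteObjects.Hadamard
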